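import Summits.Ventures.PercRepro.Conditioning
import Summits.Ventures.PercRepro.Coupling
import Summits.Ventures.PercRepro.Classical
import Summits.Ventures.PercRepro.DecisionTree
import Summits.Ventures.PercRepro.DecisionTreeHKA

/-!
# The Harris–Kleitman inequality for decision trees (Gladkov, Theorem 3.2) — the theorem

Continuation of `DecisionTreeHKA.lean` (split for the ≤ 400-line lint; proofs byte-identical): the section
«The decision-tree Harris–Kleitman inequality» — `expectPair_mono`, `DTree.hk_aux`, **`DTree.hk`**.
-/

namespace PercRepro

open Finset

variable {E : Type*} [DecidableEq E] [Fintype E]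

/-! ### The decision-tree Harris–Kleitman inequality -/

/-- Two-copy expectations are monotone in the integrand under probability weights. -/
theorem expectPair_mono {p₁ p₂ : E → ℝ} (hp₁ : IsProb p₁) (hp₂ : IsProb p₂)
    {F G : Config E → Config E → ℝ} (h : ∀ ω ω', F ω ω' ≤ G ω ω') :
    expectPair p₁ p₂ F ≤ expectPair p₁ p₂ G := by
  unfold expectPair
  refine Finset.sum_le_sum fun ω _ => Finset.sum_le_sum fun ω' _ => ?_
  exact mul_le_mul_of_nonneg_left (h ω ω') (mul_nonneg (weight_nonneg hp₁ ω) (weight_nonneg hp₂ ω'))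

/-- The inductive statement behind Theorem 3.2: for a tree proper with respect to the queried
set `Q`, two weight vectors agreeing off `Q`, a set `S₀ ⊆ Q` of edges already sent to `S` and
increasing `A`, `B`:
`P(A) · E[1_B(ω →_{S₀} ω')] ≤ E[1_A(ω) · 1_B(ω →_{S₀ ∪ S} ω')]`, `S = run t ω ω'`. -/
theorem DTree.hk_aux (t : DTree E) : ∀ (Q S₀ : Set E) (p₁ p₂ : E → ℝ), Proper t Q →
    IsProb p₁ → IsProb p₂ → (∀ e, e ∉ Q → p₁ e = p₂ e) → S₀ ⊆ Q →
    ∀ {A B : Set (Config E)}, IsUpperSet A → IsUpperSet B →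
      prob p₁ A * expectPair p₁ p₂ (fun ω ω' => B.indicator 1 (mix S₀ ω ω')) ≤
        expectPair p₁ p₂ (fun ω ω' => A.indicator 1 ω * B.indicator 1 (mix (S₀ ∪ run t ω ω') ω ω')) := by
  induction t with
  | leaf =>
    intro Q S₀ p₁ p₂ _ hp₁ hp₂ _ _ A B hA hB
    simp only [DTree.run, Set.union_empty]
    exact expectPair_harris_mix hp₁ hp₂ hA hB S₀
  | node e toS next ih =>
    intro Q S₀ p₁ p₂ ht hp₁ hp₂ hoff hS₀ A B hA hB
    obtain ⟨heQ, hnext⟩ := ht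
    have heS₀ : e ∉ S₀ := fun h => heQ (hS₀ h)
    have hce : p₁ e = p₂ e := hoff e heQ
    -- the functions `n b = E[1_B(update (ω →_{S₀} ω') e b)]`, the same under every fixing
    set n : Bool → ℝ := fun x =>
      expectPair p₁ p₂ (fun ω ω' => B.indicator 1 (Function.update (mix S₀ ω ω') e x)) with hn
    have hinv : ∀ (x b b' : Bool),
        expectPair (upd p₁ e b) (upd p₂ e b')
          (fun ω ω' => B.indicator 1 (Function.update (mix S₀ ω ω') e x)) = n x := by
      intro x b b'
      have h1 : ∀ (ω ω' : Config E) (y : Bool),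
          B.indicator (1 : Config E → ℝ) (Function.update (mix S₀ (Function.update ω e y) ω') e x) =
            B.indicator 1 (Function.update (mix S₀ ω ω') e x) := by
        intro ω ω' y; rw [update_mix_update_left]
      have h2 : ∀ (ω ω' : Config E) (y : Bool),
          B.indicator (1 : Config E → ℝ) (Function.update (mix S₀ ω (Function.update ω' e y)) e x) =
            B.indicator 1 (Function.update (mix S₀ ω ω') e x) := by
        intro ω ω' y; rw [update_mix_update_right]
      rw [hn]
      simp only
      rw [expectPair_split p₁ p₂ e]
      -- every term equals the (b, b')-term
      have hc : ∀ (c c' : Bool), expectPair (upd p₁ e c) (upd p₂ e c')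
          (fun ω ω' => B.indicator 1 (Function.update (mix S₀ ω ω') e x)) =
          expectPair (upd p₁ e b) (upd p₂ e b')
            (fun ω ω' => B.indicator 1 (Function.update (mix S₀ ω ω') e x)) :=
        fun c c' => expectPair_upd_eq h1 h2 c c' b b'
      simp only [hc, ← Finset.sum_mul, ← Finset.mul_sum, sum_cf, one_mul]
    have hnmono : n false ≤ n true := by
      rw [hn]
      refine expectPair_mono hp₁ hp₂ fun ω ω' => ?_
      have hle : Function.update (mix S₀ ω ω') e false ≤ Function.update (mix S₀ ω ω') e true := by
        intro e'
        by_cases h : e' = e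
        · subst h; simp
        · simp [Function.update_of_ne h]
      by_cases h0 : Function.update (mix S₀ ω ω') e false ∈ B
      · rw [Set.indicator_of_mem h0, Set.indicator_of_mem (hB hle h0)]
        exact le_rfl
      · rw [Set.indicator_of_notMem h0]
        exact Set.indicator_nonneg (fun _ _ => zero_le_one) _
    -- the A-side: `x b = P_{p₁[e:=b]}(A)`
    have hxmono : prob (upd p₁ e false) A ≤ prob (upd p₁ e true) A := by
      rw [upd_false, upd_true]; exact prob_update_zero_le_prob_update_one hp₁ e hA
    -- right-hand side after splitting
    have hR : expectPair p₁ p₂ (fun ω ω' => B.indicator 1 (mix S₀ ω ω')) =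
        ∑ b' : Bool, cf p₂ e b' * n b' := by
      rw [expectPair_split p₁ p₂ e]
      have key : ∀ b b' : Bool, expectPair (upd p₁ e b) (upd p₂ e b')
          (fun ω ω' => B.indicator 1 (mix S₀ ω ω')) = n b' := by
        intro b b'
        rw [← hinv b' b b']
        refine expectPair_congr fun ω ω' _ h2 => ?_
        have : ω' e = b' := eq_of_weight_upd_ne_zero h2
        congr 1
        funext e'
        by_cases h : e' = e
        · subst h; rw [Function.update_self, mix_apply_of_notMem heS₀, this]
        · rw [Function.update_of_ne h]
      simp only [key]
      rw [Finset.sum_comm]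
      simp only [← Finset.sum_mul, sum_cf, one_mul]
    -- left-hand side after splitting, with the induction hypothesis in each cell
    have hL : ∀ b b' : Bool,
        prob (upd p₁ e b) A * n (if toS then b else b') ≤
          expectPair (upd p₁ e b) (upd p₂ e b')
            (fun ω ω' => A.indicator 1 ω *
              B.indicator 1 (mix (S₀ ∪ DTree.run (DTree.node e toS next) ω ω') ω ω')) := by
      intro b b'
      set S₀' : Set E := S₀ ∪ (if toS then {e} else ∅) with hS₀'
      have hS₀'Q : S₀' ⊆ insert e Q := by
        rw [hS₀']
        refine Set.union_subset (hS₀.trans (Set.subset_insert e Q)) ?_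
        split_ifs
        · exact Set.singleton_subset_iff.mpr (Set.mem_insert e Q)
        · exact Set.empty_subset _
      have hoff' : ∀ e', e' ∉ insert e Q → upd p₁ e b e' = upd p₂ e b' e' := by
        intro e' he'
        have hne : e' ≠ e := fun h => he' (h ▸ Set.mem_insert e Q)
        have he'Q : e' ∉ Q := fun h => he' (Set.mem_insert_of_mem _ h)
        simp only [upd, Function.update_of_ne hne]
        exact hoff e' he'Q
      have hih := ih b b' (insert e Q) S₀' (upd p₁ e b) (upd p₂ e b') (hnext b b')
        (isProb_upd hp₁ e b) (isProb_upd hp₂ e b') hoff' hS₀'Q hA hB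
      -- the B-factor of the induction hypothesis is `n (if toS then b else b')`
      have hBfac : expectPair (upd p₁ e b) (upd p₂ e b') (fun ω ω' => B.indicator 1 (mix S₀' ω ω')) =
          n (if toS then b else b') := by
        rw [← hinv (if toS then b else b') b b']
        refine expectPair_congr fun ω ω' h1 h2 => ?_
        have hω : ω e = b := eq_of_weight_upd_ne_zero h1
        have hω' : ω' e = b' := eq_of_weight_upd_ne_zero h2
        congr 1
        cases toS with
        | true =>
          simp only [hS₀', if_true, Set.union_singleton, mix_insert, hω]
        | false =>
          simp only [hS₀', Bool.false_eq_true, if_false, Set.union_empty]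
          funext e'
          by_cases h : e' = e
          · subst h; rw [Function.update_self, mix_apply_of_notMem heS₀, hω']
          · rw [Function.update_of_ne h]
      rw [← hBfac]
      refine hih.trans (le_of_eq ?_)
      refine expectPair_congr fun ω ω' h1 h2 => ?_
      have hω : ω e = b := eq_of_weight_upd_ne_zero h1
      have hω' : ω' e = b' := eq_of_weight_upd_ne_zero h2
      simp only [DTree.run, hω, hω', hS₀', Set.union_assoc]
    -- assemble
    rw [hR, prob_eq_sum_cf p₁ e A, expectPair_split p₁ p₂ e]
    have hterm : ∀ b b' : Bool, cf p₁ e b * cf p₂ e b' * (prob (upd p₁ e b) A * n (if toS then b else b')) ≤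
        cf p₁ e b * cf p₂ e b' * expectPair (upd p₁ e b) (upd p₂ e b')
          (fun ω ω' => A.indicator 1 ω *
            B.indicator 1 (mix (S₀ ∪ DTree.run (DTree.node e toS next) ω ω') ω ω')) := by
      intro b b'
      have hc : 0 ≤ cf p₁ e b * cf p₂ e b' := by
        unfold cf
        split_ifs <;> nlinarith [hp₁.nonneg e, hp₁.le_one e, hp₂.nonneg e, hp₂.le_one e]
      exact mul_le_mul_of_nonneg_left (hL b b') hc
    refine le_trans ?_ (Finset.sum_le_sum fun b _ => Finset.sum_le_sum fun b' _ => hterm b b')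
    simp only [Fintype.sum_bool, cf, if_true, Bool.false_eq_true, if_false]
    rw [← hce]
    have hc0 := hp₁.nonneg e
    have hc1 := hp₁.le_one e
    cases toS with
    | true =>
      simp only [if_true]
      have := chebyshev_two_point hc0 hc1 hxmono hnmono
      nlinarith [this]
    | false =>
      simp only [Bool.false_eq_true, if_false]
      nlinarith

/-- **Gladkov's Theorem 3.2 (the Harris–Kleitman inequality for decision trees)**: for a proper
decision tree `t` building `S = run t ω ω'` from two independent configurations of law `p`, and
increasing events `A`, `B`, `P(ω ∈ A ∧ ω →_S ω' ∈ B) ≥ P(A) · P(B)`. -/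
theorem DTree.hk {p : E → ℝ} (hp : IsProb p) {t : DTree E} (ht : Proper t ∅)
    {A B : Set (Config E)} (hA : IsUpperSet A) (hB : IsUpperSet B) :
    prob p A * prob p B ≤
      ∑ ω, ∑ ω', weight p ω * weight p ω' *
        (A.indicator 1 ω * B.indicator 1 (mix (run t ω ω') ω ω')) := by
  have h := DTree.hk_aux t ∅ ∅ p p ht hp hp (fun _ _ => rfl) (Set.Subset.refl _) hA hB
  simp only [mix_empty, Set.empty_union] at h
  have hB' : expectPair p p (fun _ ω' => B.indicator 1 ω') = prob p B := by
    unfold expectPair prob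
    have : ∀ ω : Config E, ∑ ω', weight p ω * weight p ω' * B.indicator 1 ω' =
        weight p ω * ∑ ω', B.indicator (weight p) ω' := by
      intro ω
      rw [Finset.mul_sum]
      refine Finset.sum_congr rfl fun ω' _ => ?_
      by_cases h : ω' ∈ B <;> simp [h]
    simp only [this, ← Finset.sum_mul, sum_weight, one_mul]
  rw [hB'] at h
  exact h

end PercRepro
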